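import Summits.BirchSwinnertonDyer.Rank1Residual.SecondDescent.NonemptyRecordsCardFree01
import Summits.BirchSwinnertonDyer.Rank1Residual.SecondDescent.SelmerLevelCertificates
import Summits.BirchSwinnertonDyer.Rank1Residual.AdditivePotMult.RankZeroChiBranchThreeFacts
import HarnessLib

/-!
# B-1 second-3-descent `NONEMPTY × 2` chain WITHOUT the Cassels–Tate pairing: the binder `hCT` is idle (cell `b2b-bsdres`, CLASS-CLOSURE instrument seat cc-eng-4, GEN 17)

HONEST FRAMING (run/shared/lean/b2b/bsd-rank1-residual/, verbatim in every file): the goal of the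
cell is to DELETE the COMBINATION-SHAPED residual classes of the Birch–Swinnerton-Dyer formula for
ALL analytic-rank `≤ 1` elliptic curves over `ℚ` — "full BSD formula for every rank `≤ 1` curve in
class `C`" assembled STRICTLY from published theorems — so that the rank-`≤ 1` remainder becomes
exactly the CONSTRUCTION-SHAPED classes, which are TYPED (missing-input `Prop`s), NOT attempted.
This is not "finishing BSD".  This file is kernel BOOKKEEPING for the instrument B-1 (`SEL3ALT`,
Creutz's second `3`-descent): class-free and per-pair theorems; every per-curve verdict it is fed
is INSTRUMENTATION / EVIDENCE under census-lead's tier label; nothing booked; no class label,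
mark, count or tier moved; no Literature fact minted.

## The finding (F-CT-IDLE, cc-eng-4 GEN 17; zero kit)

Every `NONEMPTY × 2` theorem of record (`missingLowerBoundAt_of_casselsTate_of_two_divisible(')`,
the X8 / X7 / X6 / X4 consumers and literal-model shapes on it, the records `bsdp3_b1n_·` p304273 /
p305257 and their `hcard`-free restatements, the Selmer-level forms of `SelmerLevelCertificates`,
additive-p1's X4(M) twin `AdditivePotMult.ClassX4M.bsdp_three_rankZero_of_surj_of_two_nonempty`)
takes the named fact `hCT : exists_casselsTate_pairing` and uses it in ONE place,
`Typed.missingLowerBoundAt_of_casselsTate_of_pow_dvd` (`k = 2`), which rounds `p³ ∣ #Ш` up to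
`p⁴ ∣ #Ш` by the squareness of `#Ш`.  Here that rounding is vacuous: two `p`-torsion classes
`c₁ ≠ 0`, `c₂ ∉ ℤ∙c₁` that are both `p`-th multiples give `p⁴ ∣ #Ш` OUTRIGHT
(`pow_dvd_shaOrder_of_two_divisible'`, GEN 11: `x ↦ p • x` maps `⟨d₁, d₂⟩` onto `⟨c₁, c₂⟩` of order
`p²` with kernel `⊇ ⟨c₁, c₂⟩`), and `p⁴ ∣ #Ш` with `ord_p #Ш_an ≤ 4` IS the typed lower half
`MissingLowerBoundAt W p` (`∃ q, #Ш_an = q ∧ ord_p q ≤ ord_p #Ш`) — no parity, no pairing.  The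
theorems below are the theorems of record with `hCT` DELETED and nothing else changed: §1 the
class-free lower half (`Ш`-level, Selmer-level); §2 the `p = 3` consumers X8 / X7 / X6 (Wuthrich
upper half), X4 potentially good (Kato's), X4(M) (additive-p1's chi-branch upper half); §3 the two
literal-model shapes in use; §4 the four production records, every kernel discharge as filed.
What it buys: the named-fact inputs of a B-1 `NONEMPTY × 2` record drop from {Cassels–Tate, GZK,
upper-half facts} to {GZK, upper-half facts}; certificate binders unchanged.  Cassels–Tate stays
NEEDED on the ONE-`NONEMPTY`-plus-partner road (`…_of_one_divisible`: `p³ ∣ #Ш`) and the policy-`one`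
`EMPTY` road; it is idle on the policy-`all` `EMPTY` road (GEN 14) and here — on either verdict B-1
uses the Cassels–Tate theorem only to save ONE cubic run per row.  additive-p1's isotropic road
(`ShaIsotropicCasselsTate.lean`, ZERO Gram matrix on `Sel^(p)`) is another instrument's, untouched.
References: B. Creutz, Math. Comp. 83 (2014) §1, §7 [Creutz2014]; J. H. Silverman, *AEC* X.4
[SilvermanAEC2009]; C. Wuthrich, Trans. AMS 366 (2014) [Wuthrich2014]; K. Kato, Astérisque 295
(2004) [Kato2004Asterisque]; D. Delbourgo 1998 [Delbourgo1998]; R. L. Miller, LMS JCM 14 (2011)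
[Miller2011LMS]; J. E. Cremona's tables [Cremona2006].
-/

set_option autoImplicit false

noncomputable section

open scoped Classical

open WeierstrassCurve Literature.NumberTheory.EllipticCurves
  Literature.NumberTheory.EllipticCurves.ModularForms
  Literature.NumberTheory.EllipticCurves.Rank1Residual
  Literature.NumberTheory.EllipticCurves.Rank1Residual.Typed
  Literature.NumberTheory.EllipticCurves.Rank1Residual.X11RankOneCertificates
  Literature.NumberTheory.EllipticCurves.Wuthrich2014
  Summit.BirchSwinnertonDyer.BirchSwinnertonDyer.Rank1Residual.IntModel
  Summit.BirchSwinnertonDyer.Rank1Residual.Additive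
  Summit.BirchSwinnertonDyer.Rank1Residual.Additive.X4ThreeKuriharaCert
  Summit.BirchSwinnertonDyer.Rank1Residual.Additive.IntModelTam
  Summit.BirchSwinnertonDyer.Rank1Residual.X11b

namespace Summit.BirchSwinnertonDyer.Rank1Residual.SecondDescent

/-! ### §1. The class-free lower half from two `NONEMPTY` witnesses, NO Cassels–Tate -/

section LowerHalf

variable (W : WeierstrassCurve ℚ) [W.IsElliptic] (p : ℕ) [hp : Fact p.Prime]

/-- **The typed LOWER half at `p` from two `NONEMPTY` witnesses, NO Cassels–Tate** (finite `Ш`;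
classes `c₁ ≠ 0`, `c₂ ∉ ℤ∙c₁` with `p • cᵢ = 0`, each a `p`-th multiple `cᵢ = p • dᵢ`; `#Ш_an = q`
with `ord_p q ≤ 4`): `p⁴ ∣ #Ш` (`pow_dvd_shaOrder_of_two_divisible'`) ⇒ `ord_p q ≤ 4 ≤ ord_p #Ш`.
No `hCT`, no `hcard`. Class-free; per pair; nothing booked; cc-eng-4 GEN 17.
[cite: Creutz2014, §1] [cite: SilvermanAEC2009, Thm. X.4.2(a)]
[cite: Miller2011LMS, Def. 1.1 (arXiv:1010.2431 p. 3)] -/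
theorem missingLowerBoundAt_of_two_divisible (hfin : W.ShaFinite) {c₁ c₂ d₁ d₂ : W.sha}
    (h1 : p • c₁ = 0) (h2 : p • c₂ = 0) (hc₁ : c₁ ≠ 0) (hind : c₂ ∉ AddSubgroup.zmultiples c₁)
    (hd₁ : p • d₁ = c₁) (hd₂ : p • d₂ = c₂) {q : ℚ} (hq : shaAn W = (q : ℂ))
    (hv : padicValRat p q ≤ 4) : MissingLowerBoundAt W p := by
  have h4 : p ^ 4 ∣ W.shaOrder :=
    pow_dvd_shaOrder_of_two_divisible' W p hfin h1 h2 hc₁ hind hd₁ hd₂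
  have hn : W.shaOrder ≠ 0 := (WeierstrassCurve.shaOrder_pos W hfin).ne'
  have hle : 4 ≤ padicValNat p W.shaOrder := (padicValNat_dvd_iff_le hn).mp h4
  exact ⟨q, hq, hv.trans (by exact_mod_cast hle)⟩

/-- **The same at analytic rank `≤ 1`** (`Ш` finite by Gross–Zagier–Kolyvagin, `hGZK`) — the drop-in
replacement for `missingLowerBoundAt_of_casselsTate_of_two_divisible'` with `hCT` deleted. Per pair;
nothing booked; GEN 17. [cite: Creutz2014, §1] [cite: Miller2011LMS, Def. 1.1 (arXiv:1010.2431 p. 3)] -/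
theorem missingLowerBoundAt_of_two_divisible_of_analyticRank_le_one
    (hGZK : rank_eq_analyticRank_of_analyticRank_le_one) (hr : W.analyticRank ≤ 1)
    {c₁ c₂ d₁ d₂ : W.sha} (h1 : p • c₁ = 0) (h2 : p • c₂ = 0) (hc₁ : c₁ ≠ 0)
    (hind : c₂ ∉ AddSubgroup.zmultiples c₁) (hd₁ : p • d₁ = c₁) (hd₂ : p • d₂ = c₂) {q : ℚ}
    (hq : shaAn W = (q : ℂ)) (hv : padicValRat p q ≤ 4) : MissingLowerBoundAt W p :=
  missingLowerBoundAt_of_two_divisible W p (hGZK W hr).2 h1 h2 hc₁ hind hd₁ hd₂ hq hv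

/-- **Selmer-level binders, analytic rank `0`, NO Cassels–Tate** (=
`missingLowerBoundAt_of_casselsTate_of_two_nonempty_selmer_rankZero` with `hCT` deleted): GZK;
`#E(ℚ)[p] = 1`; two `𝔽_p`-independent Selmer elements `ξ₁, ξ₂` (`hind0`) whose classes `c₁, c₂` are
`p`-th multiples in `Ш` (the two `NONEMPTY(witness)` verdicts); `ord_p #Ш_an ≤ 4`. Per pair; GEN 17.
[cite: SilvermanAEC2009, Thm. X.4.2(a)] [cite: Creutz2014, §1] -/
theorem missingLowerBoundAt_of_two_nonempty_selmer_rankZero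
    (hGZK : rank_eq_analyticRank_of_analyticRank_le_one) (hr : W.analyticRank = 0)
    (htors : Nat.card (AddSubgroup.torsionBy W.toAffine.Point (p : ℤ)) = 1)
    {ξ₁ ξ₂ : W.galH1Torsion (p : ℤ)} (hξ₁ : ξ₁ ∈ W.selmerGroup (p : ℤ))
    (hξ₂ : ξ₂ ∈ W.selmerGroup (p : ℤ))
    (hind0 : ∀ a b : ℤ, a • ξ₁ + b • ξ₂ = 0 → (p : ℤ) ∣ a ∧ (p : ℤ) ∣ b)
    {c₁ c₂ d₁ d₂ : W.sha} (hc₁ : (c₁ : W.galH1) = W.torsionH1ToH1 (p : ℤ) ξ₁)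
    (hc₂ : (c₂ : W.galH1) = W.torsionH1ToH1 (p : ℤ) ξ₂) (hd₁ : p • d₁ = c₁) (hd₂ : p • d₂ = c₂)
    {q : ℚ} (hq : shaAn W = (q : ℂ)) (hv : padicValRat p q ≤ 4) : MissingLowerBoundAt W p := by
  obtain ⟨hc₁0, hind⟩ := sha_ne_zero_and_not_mem_zmultiples_of_selmer_of_inf_ker_eq_bot W p
    (selmerGroup_inf_ker_eq_bot_of_analyticRank_eq_zero W p hGZK hr htors) hξ₁ hξ₂ hc₁ hc₂ hind0
  exact missingLowerBoundAt_of_two_divisible_of_analyticRank_le_one W p hGZK (by omega)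
    (nsmul_eq_zero_of_coe_eq_torsionH1ToH1 W hp.out.ne_zero hξ₁ hc₁)
    (nsmul_eq_zero_of_coe_eq_torsionH1ToH1 W hp.out.ne_zero hξ₂ hc₂) hc₁0 hind hd₁ hd₂ hq hv

/-- **Selmer-level binders with the Mordell–Weil line, analytic rank `≤ 1`, NO Cassels–Tate** (=
`missingLowerBoundAt_of_casselsTate_of_two_nonempty_selmer_mwLine` with `hCT` deleted): the
Mordell–Weil part of `Sel^(p)` inside `ℤ∙δ` (`hM`), `ξ₁, ξ₂` JOINTLY independent of `δ` (`hind3`,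
reading rule F-MW-JOINT), both classes `p`-th multiples, `ord_p #Ш_an ≤ 4`. Per pair; nothing booked;
cc-eng-4 GEN 17. [cite: SilvermanAEC2009, Thm. X.4.2(a)] [cite: Creutz2014, §1] -/
theorem missingLowerBoundAt_of_two_nonempty_selmer_mwLine
    (hGZK : rank_eq_analyticRank_of_analyticRank_le_one) (hr : W.analyticRank ≤ 1)
    {δ ξ₁ ξ₂ : W.galH1Torsion (p : ℤ)}
    (hM : W.selmerGroup (p : ℤ) ⊓ (W.torsionH1ToH1 (p : ℤ)).ker ≤ AddSubgroup.zmultiples δ)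
    (hξ₁ : ξ₁ ∈ W.selmerGroup (p : ℤ)) (hξ₂ : ξ₂ ∈ W.selmerGroup (p : ℤ))
    (hind3 : ∀ a b m : ℤ, a • ξ₁ + b • ξ₂ = m • δ → (p : ℤ) ∣ a ∧ (p : ℤ) ∣ b)
    {c₁ c₂ d₁ d₂ : W.sha} (hc₁ : (c₁ : W.galH1) = W.torsionH1ToH1 (p : ℤ) ξ₁)
    (hc₂ : (c₂ : W.galH1) = W.torsionH1ToH1 (p : ℤ) ξ₂) (hd₁ : p • d₁ = c₁) (hd₂ : p • d₂ = c₂)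
    {q : ℚ} (hq : shaAn W = (q : ℂ)) (hv : padicValRat p q ≤ 4) : MissingLowerBoundAt W p := by
  obtain ⟨hc₁0, hind⟩ :=
    sha_ne_zero_and_not_mem_zmultiples_of_selmer_of_inf_ker_le_zmultiples W p hM hξ₁ hξ₂ hc₁ hc₂
      hind3
  exact missingLowerBoundAt_of_two_divisible_of_analyticRank_le_one W p hGZK hr
    (nsmul_eq_zero_of_coe_eq_torsionH1ToH1 W hp.out.ne_zero hξ₁ hc₁)
    (nsmul_eq_zero_of_coe_eq_torsionH1ToH1 W hp.out.ne_zero hξ₂ hc₂) hc₁0 hind hd₁ hd₂ hq hv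

end LowerHalf

/-! ### §2. The `p = 3` consumers with `hCT` deleted -/

/-- **X8 ∩ {r_an = 0} ∩ {surj(3)}, `ord₃ #Ш_an ≤ 4`: `BSD(E,3)` from Wuthrich's upper half + GZK +
modularity + TWO second-`3`-descent `NONEMPTY` witnesses — NO Cassels–Tate, `hcard`-free** (=
`X8.…_of_casselsTate_of_two_nonempty_of_surj'` with `hCT` deleted). EVIDENCE pointers: the 33 X8 rows
of `B1-ASK-SHA81` (staged, nothing run). Per pair; class X8 unchanged; nothing booked; GEN 17.
[cite: Wuthrich2014, Prop. 21 (p. 400)] [cite: Creutz2014, §1] [cite: Miller2011LMS, Def. 1.1] -/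
theorem X8.bsdp_three_rankZero_of_two_nonempty_of_surj (hW : sha_dvd_analyticSha)
    (hGZK : rank_eq_analyticRank_of_analyticRank_le_one) (hmod : hasEntireLFunction_rat)
    (W : WeierstrassCurve ℚ) [W.IsElliptic] [W.IsGloballyMinimal] (hX : ClassX8 W 3) (hs : Surj W 3)
    (hr : W.analyticRank = 0) {c₁ c₂ d₁ d₂ : W.sha} (h1 : 3 • c₁ = 0) (h2 : 3 • c₂ = 0)
    (hc₁ : c₁ ≠ 0) (hind : c₂ ∉ AddSubgroup.zmultiples c₁) (hd₁ : 3 • d₁ = c₁) (hd₂ : 3 • d₂ = c₂)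
    {q : ℚ} (hq : shaAn W = (q : ℂ)) (hv : padicValRat 3 q ≤ 4) : BSDp W 3 :=
  haveI : Fact (Nat.Prime 3) := ⟨Nat.prime_three⟩
  X8.bsdp_of_missingLowerBoundAt_of_surj W 3 hW hGZK hmod hX hs hr
    (missingLowerBoundAt_of_two_divisible_of_analyticRank_le_one W 3 hGZK (by omega) h1 h2 hc₁ hind
      hd₁ hd₂ hq hv)

/-- **X7 ∩ {r_an = 0}, surj(3) (per-pair datum), `ord₃ #Ш_an ≤ 4`: `BSD(E,3)` — NO Cassels–Tate,
`hcard`-free** (= `X7.…_of_casselsTate_of_two_nonempty_of_surj'` with `hCT` deleted). EVIDENCE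
pointers: the 11 X7 rows of `B1-ASK-SHA81`. Per pair; class X7 unchanged; nothing booked; GEN 17.
[cite: Wuthrich2014, Prop. 21 (p. 400)] [cite: Creutz2014, §1] [cite: Miller2011LMS, Def. 1.1] -/
theorem X7.bsdp_three_rankZero_of_two_nonempty_of_surj (hW : sha_dvd_analyticSha)
    (hGZK : rank_eq_analyticRank_of_analyticRank_le_one) (hmod : hasEntireLFunction_rat)
    (W : WeierstrassCurve ℚ) [W.IsElliptic] [W.IsGloballyMinimal] (hX : ClassX7 W 3) (hs : Surj W 3)
    (hr : W.analyticRank = 0) {c₁ c₂ d₁ d₂ : W.sha} (h1 : 3 • c₁ = 0) (h2 : 3 • c₂ = 0)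
    (hc₁ : c₁ ≠ 0) (hind : c₂ ∉ AddSubgroup.zmultiples c₁) (hd₁ : 3 • d₁ = c₁) (hd₂ : 3 • d₂ = c₂)
    {q : ℚ} (hq : shaAn W = (q : ℂ)) (hv : padicValRat 3 q ≤ 4) : BSDp W 3 :=
  haveI : Fact (Nat.Prime 3) := ⟨Nat.prime_three⟩
  X7.bsdp_of_missingLowerBoundAt_of_surj W 3 hW hGZK hmod (by norm_num) hX hs hr
    (missingLowerBoundAt_of_two_divisible_of_analyticRank_le_one W 3 hGZK (by omega) h1 h2 hc₁ hind
      hd₁ hd₂ hq hv)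

/-- **X6 ∩ {r_an = 0}, `ord₃ #Ш_an ≤ 4`: `BSD(E,3)` — NO Cassels–Tate, `hcard`-free** (image proviso
automatic for X6; = `X6.…_of_casselsTate_of_two_nonempty'` with `hCT` deleted). EVIDENCE pointers:
the N4@3 canary (records §4). Per pair; class X6 unchanged; nothing booked; cc-eng-4 GEN 17.
[cite: Wuthrich2014, Prop. 21 (p. 400)] [cite: Creutz2014, §1] [cite: Miller2011LMS, Def. 1.1] -/
theorem X6.bsdp_three_rankZero_of_two_nonempty (hW : sha_dvd_analyticSha)
    (hGZK : rank_eq_analyticRank_of_analyticRank_le_one) (hmod : hasEntireLFunction_rat)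
    (W : WeierstrassCurve ℚ) [W.IsElliptic] [W.IsGloballyMinimal] (hX : ClassX6 W 3)
    (hr : W.analyticRank = 0) {c₁ c₂ d₁ d₂ : W.sha} (h1 : 3 • c₁ = 0) (h2 : 3 • c₂ = 0)
    (hc₁ : c₁ ≠ 0) (hind : c₂ ∉ AddSubgroup.zmultiples c₁) (hd₁ : 3 • d₁ = c₁) (hd₂ : 3 • d₂ = c₂)
    {q : ℚ} (hq : shaAn W = (q : ℂ)) (hv : padicValRat 3 q ≤ 4) : BSDp W 3 :=
  haveI : Fact (Nat.Prime 3) := ⟨Nat.prime_three⟩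
  X6.bsdp_of_missingLowerBoundAt_of_analyticRank_eq_zero W 3 hW hGZK hmod (by norm_num) hX hr
    (missingLowerBoundAt_of_two_divisible_of_analyticRank_le_one W 3 hGZK (by omega) h1 h2 hc₁ hind
      hd₁ hd₂ hq hv)

/-- **X4 ∩ {r_an = 0}, `p = 3` potentially good, `ρ̄_{E,3^n}` onto for all `n`, `3 ∤ ∏ c_ℓ · c_D`,
`ord₃ #Ш_an ≤ 4`: `BSD(E,3)` from Kato's upper half + TWO `NONEMPTY` witnesses — NO Cassels–Tate,
`hcard`-free** (= `X4RankZero.…_of_kato_of_casselsTate_of_two_nonempty'` with `hCT` deleted). Per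
pair; class X4 unchanged; nothing booked; cc-eng-4 GEN 17.
[cite: Kato2004Asterisque, Thm. 14.5 (3) (p. 236)] [cite: Creutz2014, §1] [cite: Miller2011LMS, Def. 1.1] -/
theorem X4RankZero.bsdp_three_of_kato_of_two_nonempty
    (hKato : Kato2004.rankZero_padicValNat_sha_le_of_additive_potGood_of_imageContainsSL2)
    (hGZK : rank_eq_analyticRank_of_analyticRank_le_one) (hmod : hasEntireLFunction_rat)
    (W : WeierstrassCurve ℚ) [W.IsElliptic] [W.IsGloballyMinimal]
    (hr : W.analyticRank = 0) (hX : ClassX4 W 3) (hpot : 0 ≤ padicValRat 3 W.j)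
    (hsurj : ∀ n : ℕ, W.HasSurjectiveModNGaloisRep (3 ^ n : ℕ)) (htam : ¬ 3 ∣ W.tamagawaProduct)
    {N : ℕ} [NeZero N] (D : ModularParametrizationData W N) (hc : ¬ (3 : ℤ) ∣ D.maninConstant)
    {c₁ c₂ d₁ d₂ : W.sha} (h1 : 3 • c₁ = 0) (h2 : 3 • c₂ = 0) (hc₁ : c₁ ≠ 0)
    (hind : c₂ ∉ AddSubgroup.zmultiples c₁) (hd₁ : 3 • d₁ = c₁) (hd₂ : 3 • d₂ = c₂)
    {q : ℚ} (hq : shaAn W = (q : ℂ)) (hv : padicValRat 3 q ≤ 4) : BSDp W 3 :=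
  haveI : Fact (Nat.Prime 3) := ⟨Nat.prime_three⟩
  X4RankZero.bsdp_of_missingLowerBoundAt_of_kato W 3 hKato hGZK hmod hr hX hpot hsurj htam D
    (by exact_mod_cast hc)
    (missingLowerBoundAt_of_two_divisible_of_analyticRank_le_one W 3 hGZK
      (by rw [hr]; exact zero_le_one) h1 h2 hc₁ hind hd₁ hd₂ hq hv)

/-- **The same with `ρ̄_{E,9}` onto** (tower surjectivity from level `9`) — the shape of the X4
`#Ш_an = 81` window row `19215t1` — NO Cassels–Tate (= `…_of_surj9_of_casselsTate_of_two_nonempty'`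
with `hCT` deleted). Per pair; nothing booked; cc-eng-4 GEN 17.
[cite: Kato2004Asterisque, Thm. 14.5 (3) (p. 236)] [cite: Creutz2014, §1] [cite: Miller2011LMS, Def. 1.1] -/
theorem X4RankZero.bsdp_three_of_kato_of_surj9_of_two_nonempty
    (hKato : Kato2004.rankZero_padicValNat_sha_le_of_additive_potGood_of_imageContainsSL2)
    (hGZK : rank_eq_analyticRank_of_analyticRank_le_one) (hmod : hasEntireLFunction_rat)
    (W : WeierstrassCurve ℚ) [W.IsElliptic] [W.IsGloballyMinimal]
    (hr : W.analyticRank = 0) (hX : ClassX4 W 3) (hpot : 0 ≤ padicValRat 3 W.j)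
    (h9 : W.HasSurjectiveModNGaloisRep 9) (htam : ¬ 3 ∣ W.tamagawaProduct)
    {N : ℕ} [NeZero N] (D : ModularParametrizationData W N) (hc : ¬ (3 : ℤ) ∣ D.maninConstant)
    {c₁ c₂ d₁ d₂ : W.sha} (h1 : 3 • c₁ = 0) (h2 : 3 • c₂ = 0) (hc₁ : c₁ ≠ 0)
    (hind : c₂ ∉ AddSubgroup.zmultiples c₁) (hd₁ : 3 • d₁ = c₁) (hd₂ : 3 • d₂ = c₂)
    {q : ℚ} (hq : shaAn W = (q : ℂ)) (hv : padicValRat 3 q ≤ 4) : BSDp W 3 :=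
  X4RankZero.bsdp_three_of_kato_of_two_nonempty hKato hGZK hmod W hr hX hpot
    (WeierstrassCurve.forall_hasSurjectiveModNGaloisRep_three_pow_of_nine W h9) htam D hc h1 h2 hc₁
    hind hd₁ hd₂ hq hv

/-- **X4(M) ∧ `r_an = 0` ∧ surj(3), `ord₃ #Ш_an ≤ 4`: `BSD(E,3)` from additive-p1's published upper
half (`AdditivePotMult.ClassX4M.bsdp_three_rankZero_of_surj_of_lower`: Delbourgo / GZK / modularity /
Wuthrich Lemma 20 / Kato Thm. 17.4 chi-branch) + TWO `NONEMPTY` witnesses — NO Cassels–Tate** (=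
`AdditivePotMult.ClassX4M.…_of_surj_of_two_nonempty` with `hCT` deleted). EVIDENCE pointers: the 34
`SHA81-M` rows (`census-g17/SHA81-M-ROWS.tsv` c006c28fcfcd133f; nothing run). Per pair; GEN 17.
[cite: Delbourgo1998, Prop. 4 (p. 144)] [cite: Wuthrich2014, Lemma 20 (p. 399), Cor. 19 (p. 398)]
[cite: Kato2004Asterisque, Thm. 17.4 (3) (p. 273)] [cite: Creutz2014, §1] -/
theorem bsdp_three_rankZero_classX4M_of_surj_of_two_nonempty
    (hDel : Delbourgo1998.prop4_rankZero_pow_dvd_constantCoeff)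
    (hGZK : rank_eq_analyticRank_of_analyticRank_le_one) (hmod : hasEntireLFunction_rat)
    (hmodD : nonempty_modularParametrizationData)
    (hL20 : Wuthrich2014.lemma20_surjective_threeAdic_of_semistable)
    (hKato : Wuthrich2014.kato_minusEigenCharIdeal_dvd_cyclotomicThree_of_surjective)
    (W : WeierstrassCurve ℚ) [W.IsElliptic] [W.IsGloballyMinimal]
    (hX : AdditivePotMult.ClassX4M W 3) (hr : W.analyticRank = 0) (hsurj : Surj W 3)
    {c₁ c₂ d₁ d₂ : W.sha} (h1 : 3 • c₁ = 0) (h2 : 3 • c₂ = 0) (hc₁ : c₁ ≠ 0)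
    (hind : c₂ ∉ AddSubgroup.zmultiples c₁) (hd₁ : 3 • d₁ = c₁) (hd₂ : 3 • d₂ = c₂)
    {q : ℚ} (hq : shaAn W = (q : ℂ)) (hv : padicValRat 3 q ≤ 4) : BSDp W 3 :=
  haveI : Fact (Nat.Prime 3) := ⟨Nat.prime_three⟩
  AdditivePotMult.ClassX4M.bsdp_three_rankZero_of_surj_of_lower hDel hGZK hmod hmodD hL20 hKato hX
    hr hsurj
    (missingLowerBoundAt_of_two_divisible_of_analyticRank_le_one W 3 hGZK (by omega) h1 h2 hc₁ hind
      hd₁ hd₂ hq hv)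

/-! ### §3. The two literal-model record SHAPES in use, with `hCT` deleted -/

/-- **X6 ∩ {r_an = 0}, literal model, `Ш` currency, NO Cassels–Tate, `hcard`-free** (=
`X6.bsdp_three_rankZero_of_ainvs_of_casselsTate_of_two_nonempty'` with `hCT` deleted). Per pair;
class X6 unchanged; nothing booked; cc-eng-4 GEN 17. [cite: Wuthrich2014, Prop. 21 (p. 400)]
[cite: Creutz2014, §1] [cite: Miller2011LMS, §1 and Def. 1.1] -/
theorem X6.bsdp_three_rankZero_of_ainvs_of_two_nonempty (hW : sha_dvd_analyticSha)
    (hGZK : rank_eq_analyticRank_of_analyticRank_le_one) (hmod : hasEntireLFunction_rat)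
    (a1 a2 a3 a4 a6 : ℤ) (hΔ : discOf [a1, a2, a3, a4, a6] ≠ 0)
    (hmin : (⟨a1, a2, a3, a4, a6⟩ : WeierstrassCurve ℚ).IsGloballyMinimal)
    (hX : haveI := hmin; ClassX6 (⟨a1, a2, a3, a4, a6⟩ : WeierstrassCurve ℚ) 3)
    (hr : (⟨a1, a2, a3, a4, a6⟩ : WeierstrassCurve ℚ).analyticRank = 0)
    {c₁ c₂ d₁ d₂ : (⟨a1, a2, a3, a4, a6⟩ : WeierstrassCurve ℚ).sha} (h1 : 3 • c₁ = 0)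
    (h2 : 3 • c₂ = 0) (hc₁ : c₁ ≠ 0) (hind : c₂ ∉ AddSubgroup.zmultiples c₁) (hd₁ : 3 • d₁ = c₁)
    (hd₂ : 3 • d₂ = c₂)
    {q : ℚ} (hq : shaAn (⟨a1, a2, a3, a4, a6⟩ : WeierstrassCurve ℚ) = (q : ℂ))
    (hv : padicValRat 3 q ≤ 4) : BSDp (⟨a1, a2, a3, a4, a6⟩ : WeierstrassCurve ℚ) 3 := by
  haveI := isElliptic_of_discOf_ne_zero a1 a2 a3 a4 a6 hΔ
  haveI := hmin
  exact X6.bsdp_three_rankZero_of_two_nonempty hW hGZK hmod _ hX hr h1 h2 hc₁ hind hd₁ hd₂ hq hv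

/-- **X4 `NONEMPTY × 2` reading for a literal model, `p = 3`, analytic rank `0`, `ρ̄_{E,9}` onto,
NO Cassels–Tate, `hcard`-free** (= `…_of_ainvs_of_kato_of_surj9_of_casselsTate_of_two_nonempty'`
with `hCT` deleted). Per pair; class X4 unchanged; nothing booked; cc-eng-4 GEN 17.
[cite: Kato2004Asterisque, Thm. 14.5 (3) (p. 236)] [cite: Creutz2014, §1] [cite: Miller2011LMS, Def. 1.1] -/
theorem X4RankZero.bsdp_three_of_ainvs_of_kato_of_surj9_of_two_nonempty
    (hKato : Kato2004.rankZero_padicValNat_sha_le_of_additive_potGood_of_imageContainsSL2)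
    (hGZK : rank_eq_analyticRank_of_analyticRank_le_one) (hmod : hasEntireLFunction_rat)
    (a1 a2 a3 a4 a6 : ℤ) (hΔ : discOf [a1, a2, a3, a4, a6] ≠ 0)
    (hmin : (⟨a1, a2, a3, a4, a6⟩ : WeierstrassCurve ℚ).IsGloballyMinimal)
    (hr : (⟨a1, a2, a3, a4, a6⟩ : WeierstrassCurve ℚ).analyticRank = 0)
    (hX : ClassX4 (⟨a1, a2, a3, a4, a6⟩ : WeierstrassCurve ℚ) 3)
    (hpot : haveI := isElliptic_of_discOf_ne_zero a1 a2 a3 a4 a6 hΔ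
      0 ≤ padicValRat 3 (⟨a1, a2, a3, a4, a6⟩ : WeierstrassCurve ℚ).j)
    (h9 : (⟨a1, a2, a3, a4, a6⟩ : WeierstrassCurve ℚ).HasSurjectiveModNGaloisRep 9)
    (htam : ¬ 3 ∣ (⟨a1, a2, a3, a4, a6⟩ : WeierstrassCurve ℚ).tamagawaProduct)
    {N : ℕ} [NeZero N] (D : ModularParametrizationData (⟨a1, a2, a3, a4, a6⟩ : WeierstrassCurve ℚ) N)
    (hc : ¬ (3 : ℤ) ∣ D.maninConstant)
    {c₁ c₂ d₁ d₂ : (⟨a1, a2, a3, a4, a6⟩ : WeierstrassCurve ℚ).sha} (h1 : 3 • c₁ = 0)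
    (h2 : 3 • c₂ = 0) (hc₁ : c₁ ≠ 0) (hind : c₂ ∉ AddSubgroup.zmultiples c₁) (hd₁ : 3 • d₁ = c₁)
    (hd₂ : 3 • d₂ = c₂)
    {q : ℚ} (hq : shaAn (⟨a1, a2, a3, a4, a6⟩ : WeierstrassCurve ℚ) = (q : ℂ))
    (hv : padicValRat 3 q ≤ 4) : BSDp (⟨a1, a2, a3, a4, a6⟩ : WeierstrassCurve ℚ) 3 := by
  haveI := isElliptic_of_discOf_ne_zero a1 a2 a3 a4 a6 hΔ
  haveI := hmin
  exact X4RankZero.bsdp_three_of_kato_of_surj9_of_two_nonempty hKato hGZK hmod _ hr hX hpot h9 htam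
    D hc h1 h2 hc₁ hind hd₁ hd₂ hq hv

/-! ### §4. The four B-1 `NONEMPTY × 2` production records of record, re-derived with `hCT` deleted -/

/-- **`BSD(E,3)` for `19215t1`, NO Cassels–Tate, `hcard`-free** [= `bsdp3_b1n_19215t1` (p304273) /
`bsdp3_b1n_19215t1'` with `hCT` DELETED; kernel discharges exactly as there] (`N = 3²·5·7·61`; X4
(I₀*) at `3`; `r_an = 0`, `#E(ℚ)_tors = 1`, `∏ c_ℓ = 2`, `#Ш_an = 81`). Named facts `hKato` (FLAG:
D-audit OPEN), `hGZK`, `hmod`; witnesses `h1 h2 hc₁ hind hd₁ hd₂` (EVIDENCE: kit j138775 + j139038,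
both engines, XVERIFY 4/4). Per pair; class X4 unchanged; nothing booked; cc-eng-4 GEN 17.
[cite: Kato2004Asterisque, Thm. 14.5 (3) (p. 236)] [cite: Creutz2014, §1 and §7]
[cite: Serre1972, §2.4 Prop. 15] [cite: SilvermanAEC2009, VII.5 Prop. 5.5]
[cite: Miller2011LMS, §1 and Def. 1.1] [cite: Cremona2006, Table 1 (Cremona label 19215t1)] -/
theorem bsdp3_b1n_19215t1''
    (hKato : Kato2004.rankZero_padicValNat_sha_le_of_additive_potGood_of_imageContainsSL2)
    (hGZK : rank_eq_analyticRank_of_analyticRank_le_one) (hmod : hasEntireLFunction_rat)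
    (W : WeierstrassCurve ℚ) (hW : W = ⟨0, 0, 1, -10107597, -12660392115⟩)
    (hr : W.analyticRank = 0)
    {N : ℕ} [NeZero N] (D : ModularParametrizationData W N) (hc : ¬ (3 : ℤ) ∣ D.maninConstant)
    {c₁ c₂ d₁ d₂ : W.sha} (h1 : 3 • c₁ = 0) (h2 : 3 • c₂ = 0) (hc₁ : c₁ ≠ 0)
    (hind : c₂ ∉ AddSubgroup.zmultiples c₁) (hd₁ : 3 • d₁ = c₁) (hd₂ : 3 • d₂ = c₂)
    {q : ℚ} (hq : shaAn W = (q : ℂ)) (hv : padicValRat 3 q ≤ 4) : BSDp W 3 := by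
  subst hW
  -- the consumer and the `IntModel` tools speak about the CAST model (definitionally the literal one)
  haveI hE' : (⟨((0 : ℤ) : ℚ), ((0 : ℤ) : ℚ), ((1 : ℤ) : ℚ), ((-10107597 : ℤ) : ℚ),
      ((-12660392115 : ℤ) : ℚ)⟩ : WeierstrassCurve ℚ).IsElliptic :=
    isElliptic_of_discOf_ne_zero 0 0 1 (-10107597) (-12660392115) (by decide +kernel)
  haveI hM' : (⟨((0 : ℤ) : ℚ), ((0 : ℤ) : ℚ), ((1 : ℤ) : ℚ), ((-10107597 : ℤ) : ℚ),
      ((-12660392115 : ℤ) : ℚ)⟩ : WeierstrassCurve ℚ).IsGloballyMinimal :=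
    isGloballyMinimal_of_krausCriterion_bounded₂ 0 0 1 (-10107597) (-12660392115) (by decide +kernel)
      (by decide +kernel) (by decide +kernel)
  have hI : integralModelInt ((⟨((0 : ℤ) : ℚ), ((0 : ℤ) : ℚ), ((1 : ℤ) : ℚ), ((-10107597 : ℤ) : ℚ),
      ((-12660392115 : ℤ) : ℚ)⟩ : WeierstrassCurve ℚ)) =
      ((⟨0, 0, 1, -10107597, -12660392115⟩ : WeierstrassCurve ℤ)) :=
    integralModelInt_eq_of_map_eq _ (map_mk_int 0 0 1 (-10107597) (-12660392115))
  exact X4RankZero.bsdp_three_of_ainvs_of_kato_of_surj9_of_two_nonempty hKato hGZK hmod 0 0 1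
    (-10107597) (-12660392115) (by decide +kernel) hM' hr
    (classX4_three_of_intModel_of_surj hI (by decide +kernel) (by decide +kernel) (surj3_v19215t1 hI))
    (padicValRat_j_nonneg_of_intModel hI 3 2 (by decide +kernel) (by decide +kernel))
    (by simpa using towerSurj3_v19215t1 hI 2)
    (by rw [tamagawaProduct_v19215t1 hI]; decide) D hc h1 h2 hc₁ hind hd₁ hd₂ hq hv

/-- **`BSD(E,3)` for `271726d1`, NO Cassels–Tate, `hcard`-free** [= `bsdp3_b1n_271726d1` (p305257) /
`bsdp3_b1n_271726d1'` with `hCT` DELETED; `Δ ≠ 0`, minimality, `ClassX6 W 3` discharged in the kernel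
as there] (`N = 2·7·13·1493`; good supersingular at `3`; `r_an = 0`, `#E(ℚ)_tors = 1`, `∏ c_ℓ = 2`,
`#Ш_an = 81`). Named facts `hW`, `hGZK`, `hmod`; witnesses `h1 h2 hc₁ hind hd₁ hd₂` (EVIDENCE: kit
j139998 step X on the frozen `SEL3ALT-0.3`, both engines, XVERIFY; front j139937). Per pair; class
X6 unchanged; nothing booked; cc-eng-4 GEN 17. [cite: Wuthrich2014, Prop. 21 (p. 400)]
[cite: Creutz2014, §1 and §7] [cite: Cremona2006, Table 1 (Cremona label 271726d1)] -/
theorem bsdp3_b1n_271726d1'' (hW : sha_dvd_analyticSha)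
    (hGZK : rank_eq_analyticRank_of_analyticRank_le_one) (hmod : hasEntireLFunction_rat)
    (W : WeierstrassCurve ℚ) (hWm : W = ⟨1, -1, 1, -17696338, -28651334301⟩)
    (hr : W.analyticRank = 0)
    {c₁ c₂ d₁ d₂ : W.sha} (h1 : 3 • c₁ = 0) (h2 : 3 • c₂ = 0) (hc₁ : c₁ ≠ 0)
    (hind : c₂ ∉ AddSubgroup.zmultiples c₁) (hd₁ : 3 • d₁ = c₁) (hd₂ : 3 • d₂ = c₂)
    {q : ℚ} (hq : shaAn W = (q : ℂ)) (hv : padicValRat 3 q ≤ 4) : BSDp W 3 := by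
  subst hWm
  exact X6.bsdp_three_rankZero_of_ainvs_of_two_nonempty hW hGZK hmod
    1 (-1) 1 (-17696338) (-28651334301) (by decide +kernel) isGloballyMinimal_s271726d1
    classX6_s271726d1 hr h1 h2 hc₁ hind hd₁ hd₂ hq hv

/-- **`BSD(E,3)` for `405130d1`, NO Cassels–Tate, `hcard`-free** [= `bsdp3_b1n_405130d1` (p305257) /
`bsdp3_b1n_405130d1'` with `hCT` DELETED; kernel discharges as there] (`N = 2·5·11·29·127`; good
supersingular at `3`; `r_an = 0`, `#E(ℚ)_tors = 1`, `∏ c_ℓ = 2`, `#Ш_an = 81`). Named facts `hW`,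
`hGZK`, `hmod`; witnesses (EVIDENCE: kit j139998 step X, both engines, XVERIFY; front j139937). Per
pair; class X6 unchanged; nothing booked; cc-eng-4 GEN 17. [cite: Wuthrich2014, Prop. 21 (p. 400)]
[cite: Creutz2014, §1 and §7] [cite: Cremona2006, Table 1 (Cremona label 405130d1)] -/
theorem bsdp3_b1n_405130d1'' (hW : sha_dvd_analyticSha)
    (hGZK : rank_eq_analyticRank_of_analyticRank_le_one) (hmod : hasEntireLFunction_rat)
    (W : WeierstrassCurve ℚ) (hWm : W = ⟨1, -1, 0, -346934240, -2487159945344⟩)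
    (hr : W.analyticRank = 0)
    {c₁ c₂ d₁ d₂ : W.sha} (h1 : 3 • c₁ = 0) (h2 : 3 • c₂ = 0) (hc₁ : c₁ ≠ 0)
    (hind : c₂ ∉ AddSubgroup.zmultiples c₁) (hd₁ : 3 • d₁ = c₁) (hd₂ : 3 • d₂ = c₂)
    {q : ℚ} (hq : shaAn W = (q : ℂ)) (hv : padicValRat 3 q ≤ 4) : BSDp W 3 := by
  subst hWm
  exact X6.bsdp_three_rankZero_of_ainvs_of_two_nonempty hW hGZK hmod
    1 (-1) 0 (-346934240) (-2487159945344) (by decide +kernel) isGloballyMinimal_s405130d1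
    classX6_s405130d1 hr h1 h2 hc₁ hind hd₁ hd₂ hq hv

/-- **`BSD(E,3)` for `152330l1`, NO Cassels–Tate, `hcard`-free** [= `bsdp3_b1n_152330l1` (p305257) /
`bsdp3_b1n_152330l1'` with `hCT` DELETED; kernel discharges as there] (`N = 2·5·15233`; good
supersingular at `3`; `r_an = 0`, `#E(ℚ)_tors = 1`, `∏ c_ℓ = 2`, `#Ш_an = 81`). Named facts `hW`,
`hGZK`, `hmod`; witnesses (EVIDENCE: kit j139998 step X, both engines, XVERIFY; front j139937). Per
pair; class X6 unchanged; nothing booked; cc-eng-4 GEN 17. [cite: Wuthrich2014, Prop. 21 (p. 400)]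
[cite: Creutz2014, §1 and §7] [cite: Cremona2006, Table 1 (Cremona label 152330l1)] -/
theorem bsdp3_b1n_152330l1'' (hW : sha_dvd_analyticSha)
    (hGZK : rank_eq_analyticRank_of_analyticRank_le_one) (hmod : hasEntireLFunction_rat)
    (W : WeierstrassCurve ℚ) (hWm : W = ⟨1, -1, 0, -22959594440, -1339036978455744⟩)
    (hr : W.analyticRank = 0)
    {c₁ c₂ d₁ d₂ : W.sha} (h1 : 3 • c₁ = 0) (h2 : 3 • c₂ = 0) (hc₁ : c₁ ≠ 0)
    (hind : c₂ ∉ AddSubgroup.zmultiples c₁) (hd₁ : 3 • d₁ = c₁) (hd₂ : 3 • d₂ = c₂)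
    {q : ℚ} (hq : shaAn W = (q : ℂ)) (hv : padicValRat 3 q ≤ 4) : BSDp W 3 := by
  subst hWm
  exact X6.bsdp_three_rankZero_of_ainvs_of_two_nonempty hW hGZK hmod
    1 (-1) 0 (-22959594440) (-1339036978455744) (by decide +kernel) isGloballyMinimal_s152330l1
    classX6_s152330l1 hr h1 h2 hc₁ hind hd₁ hd₂ hq hv

end Summit.BirchSwinnertonDyer.Rank1Residual.SecondDescent

end
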